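import Summits.HubbardSuperconductivity.HubbardSuperconductivity.Theorems.SoloBlindTwistLocalInvisibility
import Summits.HubbardSuperconductivity.HubbardSuperconductivity.Theorems.SoloBlindPairFieldLocality
import HarnessLib

/-!
# The low-order competitor is invisible to all LOCAL observables, up to `O(1/L)`

Obstruction report, Theorem 12 (extends Theorem 2(e) = `SoloBlindTwistLocalInvisibility` from
diagonal observables to arbitrary local ones).

The competitor `φ = W_jᴴ ψ` of `dWave_order_not_energy_robust` / `dWave_order_not_diagonal_robust`
is the image of the ground state `ψ` under the Bloch–Lieb–Schultz–Mattis twist `W_j = exp(2πi j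
X₁/L)` with a winding `1 ≤ j ≤ M(c) = ⌊400/c⌋ + 1` that does NOT grow with `L`. On the CAR algebra
`𝔄(S)` of a set `S` of sites the twist acts as the gauge transformation by the phases
`e^{2πi j x₁/L}`, `x ∈ S`; in a state of fixed particle number a constant phase is a scalar, so
only the RELATIVE phases across `S` matter, and these are `1 + O(j · diam₁(S)/L)`. Hence
(`dWave_order_not_locally_robust`): for every finite set `S` of sites contained in `D + 1`
consecutive `e₁`-columns and every observable `A ∈ 𝔄(S)` — diagonal or not, gauge invariant or
not —

  `|⟨φ, A φ⟩ - ⟨ψ, A ψ⟩| ≤ 8π M(c) · D · |S| · ‖A‖ / L`.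

So the competitor has the same energy up to `ε(c,t) = O(1)`, the same sector, EXACTLY the same
diagonal correlations at all distances, the same expectation of every local observable up to
`O(D|S|/L)` (in particular the same pair–pair, hopping and current correlation functions at any
FIXED range), and yet d-wave order `< c L⁴`. A finite-volume criterion that certifies the summit's
order from hypotheses on ground states must therefore use either an energy resolution finer than
`O(1)` or an observable that is BOTH off-diagonal AND of range comparable to `L` — such as the order
parameter `Δ_dᴴ Δ_d` itself (requirement R8 of the report).

Contents:
* `norm_prod_sub_one_le` — `‖∏ aᵢ - 1‖ ≤ Σ ‖aᵢ - 1‖` for `‖aᵢ‖ ≤ 1`;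
* `norm_phaseGauge_le_one`, `norm_phaseGauge_sub_one_le` — `‖W_g‖ ≤ 1`,
  `‖W_g - 1‖ ≤ 2 Σ_x ‖g(x) - 1‖`;
* `commute_phaseGauge_of_mem_carSubalgebra` — a gauge transformation trivial on `S` commutes
  with `𝔄(S)` (Bratteli–Robinson II §5.2.2: `*`-automorphisms fixing the generators);
* `phaseGauge_const_mulVec_of_mem_szSector` — a constant phase acts on the `N`-particle sector as
  the scalar `c^N`;
* `norm_conj_sub_le` — `‖P A Pᴴ - A‖ ≤ 2 ‖P - 1‖ ‖A‖` for `‖Pᴴ‖ ≤ 1`;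
* `twist_expect_eq_localTwist_expect` — `⟨W_mᴴψ, A W_mᴴψ⟩ = ⟨ψ, W^S A (W^S)ᴴ ψ⟩` with the LOCAL
  relative twist `W^S = phaseGauge (localTwistChar m x₀ S)`;
* `norm_twist_expect_sub_expect_le` — the `O(j D |S| ‖A‖ / L)` bound for `A ∈ 𝔄(S)`;
* `dWave_order_not_locally_robust` — Theorem 12.

References: E. Lieb, T. Schultz, D. Mattis, Ann. Phys. 16 (1961) 407; H. Tasaki, J. Stat. Phys.
170 (2018) 653 (arXiv:1708.05186, local twist operators); H. Tasaki, arXiv:2202.06243 §3 (the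
twist as an approximately local `*`-automorphism); O. Bratteli, D. W. Robinson, Operator Algebras
and Quantum Statistical Mechanics II, §5.2.2. Tags: [folklore] for the lemmas, [this work] for the
assembled statement.
-/

namespace Summit.HubbardSuperconductivity.HubbardSuperconductivity.Theorems.GaugeTwist

open Matrix Finset Literature.MathematicalPhysics.QuantumLattice HubbardWave0
  Literature.MathematicalPhysics.QuantumFieldTheory
open scoped ComplexConjugate ComplexOrder Matrix.Norms.L2Operator

-- file-local, as in the sibling `SoloBlind*` files: instance synthesis for
-- `DecidableEq (Orb (FermionTorus 2 L))` must agree with the landed terms.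
attribute [-instance] instDecidableEqLex

/-! ### Scalar and diagonal estimates -/

section Abstract

/-- `‖∏ᵢ aᵢ - 1‖ ≤ Σᵢ ‖aᵢ - 1‖` when every `‖aᵢ‖ ≤ 1`. [folklore] -/
theorem norm_prod_sub_one_le {ι : Type*} (s : Finset ι) (f : ι → ℂ)
    (hf : ∀ i ∈ s, ‖f i‖ ≤ 1) : ‖∏ i ∈ s, f i - 1‖ ≤ ∑ i ∈ s, ‖f i - 1‖ := by
  classical
  induction s using Finset.induction_on with
  | empty => simp
  | insert a s ha ih =>
    rw [Finset.prod_insert ha, Finset.sum_insert ha,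
      show f a * ∏ i ∈ s, f i - 1 = f a * (∏ i ∈ s, f i - 1) + (f a - 1) by ring]
    have hfa : ‖f a‖ ≤ 1 := hf a (Finset.mem_insert_self a s)
    have ih' := ih fun i hi => hf i (Finset.mem_insert_of_mem hi)
    calc ‖f a * (∏ i ∈ s, f i - 1) + (f a - 1)‖
        ≤ ‖f a * (∏ i ∈ s, f i - 1)‖ + ‖f a - 1‖ := norm_add_le _ _
      _ ≤ 1 * ‖∏ i ∈ s, f i - 1‖ + ‖f a - 1‖ := by rw [norm_mul]; gcongr
      _ ≤ ‖f a - 1‖ + ∑ i ∈ s, ‖f i - 1‖ := by linarith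

variable {Λ : Type*} [LinearOrder Λ] [Fintype Λ]

omit [LinearOrder Λ] [Fintype Λ] in
/-- The product of unit phases over an occupation configuration, as a complex number. [folklore] -/
theorem coe_prod_circle (g : Λ → Circle) (s : Finset (Orb Λ)) :
    ((∏ o ∈ s, g (ofLex o).1 : Circle) : ℂ) = ∏ o ∈ s, (g (ofLex o).1 : ℂ) := by
  rw [← Circle.coeHom_apply, map_prod]
  rfl

/-- `‖W_g‖ ≤ 1` (a diagonal matrix of unit phases). [folklore] -/
theorem norm_phaseGauge_le_one (g : Λ → Circle) : ‖phaseGauge g‖ ≤ 1 := by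
  rw [phaseGauge_eq, Matrix.l2_opNorm_diagonal]
  refine (pi_norm_le_iff_of_nonneg zero_le_one).2 fun s => ?_
  rw [Circle.norm_coe]

omit [LinearOrder Λ] in
/-- A sum over orbitals `(x, σ)` of a function of the site is twice the sum over sites.
[folklore] -/
theorem sum_orb_eq_two_mul_sum (h : Λ → ℝ) :
    ∑ o : Orb Λ, h (ofLex o).1 = 2 * ∑ x : Λ, h x := by
  rw [← Fintype.sum_equiv (toLex : Λ × Fin 2 ≃ Orb Λ) (fun p => h p.1) (fun o => h (ofLex o).1)
    fun p => rfl, Fintype.sum_prod_type, Finset.mul_sum]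
  exact Finset.sum_congr rfl fun x _ => by simp [two_mul]

/-- **`‖W_g - 1‖ ≤ 2 Σ_x ‖g(x) - 1‖`**: a gauge transformation whose phases are close to `1` is
close to the identity in operator norm (each configuration picks up `∏_{(x,σ) ∈ s} g(x)`, and
`‖∏ aᵢ - 1‖ ≤ Σ ‖aᵢ - 1‖`). [folklore] -/
theorem norm_phaseGauge_sub_one_le (g : Λ → Circle) :
    ‖phaseGauge g - 1‖ ≤ 2 * ∑ x : Λ, ‖(g x : ℂ) - 1‖ := by
  have hdiag : phaseGauge g - 1 =
      diagonal fun s : Finset (Orb Λ) => (∏ o ∈ s, (g (ofLex o).1 : ℂ)) - 1 := by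
    ext s t
    rw [Matrix.sub_apply, phaseGauge_eq, diagonal_apply, diagonal_apply, one_apply]
    split_ifs with h
    · rw [coe_prod_circle]
    · rw [sub_zero]
  rw [hdiag, Matrix.l2_opNorm_diagonal]
  refine (pi_norm_le_iff_of_nonneg (by positivity)).2 fun s => ?_
  calc ‖(∏ o ∈ s, (g (ofLex o).1 : ℂ)) - 1‖ ≤ ∑ o ∈ s, ‖(g (ofLex o).1 : ℂ) - 1‖ :=
        norm_prod_sub_one_le s _ fun o _ => by rw [Circle.norm_coe]
    _ ≤ ∑ o : Orb Λ, ‖(g (ofLex o).1 : ℂ) - 1‖ :=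
        Finset.sum_le_univ_sum_of_nonneg fun _ => norm_nonneg _
    _ = 2 * ∑ x : Λ, ‖(g x : ℂ) - 1‖ := sum_orb_eq_two_mul_sum fun x => ‖(g x : ℂ) - 1‖

/-- **Gauge transformations trivial on `S` commute with the CAR algebra `𝔄(S)`**: if `g(x) = 1`
for all `x ∈ S` then `W_g A = A W_g` for every `A ∈ 𝔄(S)` (`W_g c_{xσ} W_gᴴ = conj(g x) c_{xσ}
= c_{xσ}` on the generators, and conjugation is a `*`-automorphism). Bratteli–Robinson II
§5.2.2. [folklore] -/
theorem commute_phaseGauge_of_mem_carSubalgebra {S : Finset Λ} {g : Λ → Circle}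
    (hg : ∀ x ∈ S, g x = 1) {A : Matrix (Finset (Orb Λ)) (Finset (Orb Λ)) ℂ}
    (hA : A ∈ carSubalgebra (orbSet S)) : Commute (phaseGauge g) A := by
  induction hA using Algebra.adjoin_induction with
  | mem B hB =>
    obtain ⟨l, hl, rfl⟩ := hB
    have hx : g (ofLex l.1).1 = 1 := hg _ (mem_orbSet.1 hl)
    have key : phaseGauge g * letterOp l * (phaseGauge g)ᴴ = letterOp l := by
      obtain ⟨i, b⟩ := l
      have hi : orb (ofLex i).1 (ofLex i).2 = i := rfl
      cases b with
      | false =>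
        simp only [letterOp, Bool.false_eq_true, ↓reduceIte]
        rw [← hi, phaseGauge_mul_annihilation_mul_conjTranspose]
        simp only at hx
        rw [hx, Circle.coe_one, map_one, one_smul]
      | true =>
        simp only [letterOp, ↓reduceIte]
        rw [← hi, phaseGauge_mul_creation_mul_conjTranspose]
        simp only at hx
        rw [hx, Circle.coe_one, one_smul]
    show phaseGauge g * letterOp l = letterOp l * phaseGauge g
    calc phaseGauge g * letterOp l
        = phaseGauge g * letterOp l * ((phaseGauge g)ᴴ * phaseGauge g) := by
          rw [conjTranspose_phaseGauge_mul_self, mul_one]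
      _ = letterOp l * phaseGauge g := by rw [← mul_assoc, key]
  | algebraMap r => exact Algebra.commute_algebraMap_right r _
  | add x y _ _ hx hy => exact hx.add_right hy
  | mul x y _ _ hx hy => exact hx.mul_right hy

/-- **A constant phase is a scalar on each particle-number sector**: `W_{c} ψ = c^N ψ` for
`ψ ∈ (N, S^z = M)`. [folklore] -/
theorem phaseGauge_const_mulVec_of_mem_szSector (c : Circle) {N : ℕ} {M : ℝ} {ψ : Fock (Orb Λ)}
    (h : ψ ∈ szSector N M) : phaseGauge (fun _ : Λ => c) *ᵥ ψ = ((c ^ N : Circle) : ℂ) • ψ := by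
  rw [mem_szSector_iff] at h
  funext s
  rw [phaseGauge_mulVec_apply, Pi.smul_apply, smul_eq_mul, Finset.prod_const]
  by_cases hs : s.card = N
  · rw [hs]
  · rw [h.1 s hs, mul_zero, mul_zero]

/-- `‖P A Pᴴ - A‖ ≤ 2 ‖P - 1‖ ‖A‖` whenever `‖Pᴴ‖ ≤ 1`. [folklore] -/
theorem norm_conj_sub_le {n : Type*} [Fintype n] [DecidableEq n] (P A : Matrix n n ℂ)
    (hP : ‖Pᴴ‖ ≤ 1) : ‖P * A * Pᴴ - A‖ ≤ 2 * ‖P - 1‖ * ‖A‖ := by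
  have hsplit : P * A * Pᴴ - A = (P - 1) * A * Pᴴ + A * (Pᴴ - 1) := by noncomm_ring
  have h1 : ‖(P - 1) * A * Pᴴ‖ ≤ ‖P - 1‖ * ‖A‖ := by
    calc ‖(P - 1) * A * Pᴴ‖ ≤ ‖P - 1‖ * ‖A‖ * ‖Pᴴ‖ :=
          (norm_mul_le _ _).trans (mul_le_mul_of_nonneg_right (norm_mul_le _ _) (norm_nonneg _))
      _ ≤ ‖P - 1‖ * ‖A‖ * 1 := by gcongr
      _ = ‖P - 1‖ * ‖A‖ := mul_one _
  have h2 : ‖A * (Pᴴ - 1)‖ ≤ ‖P - 1‖ * ‖A‖ := by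
    calc ‖A * (Pᴴ - 1)‖ ≤ ‖A‖ * ‖Pᴴ - 1‖ := norm_mul_le _ _
      _ = ‖P - 1‖ * ‖A‖ := by
          rw [show Pᴴ - 1 = (P - 1)ᴴ by rw [conjTranspose_sub, conjTranspose_one],
            Matrix.l2_opNorm_conjTranspose, mul_comm]
  rw [hsplit]
  exact (norm_add_le _ _).trans (by linarith)

end Abstract

/-! ### The twist restricted to a set of sites -/

variable {L : ℕ} [NeZero L]

/-- The RELATIVE twist phases on the site set `S`, based at `x₀`:
`u ↦ e^{2πi m (u₁ - x₀,₁)/L}` for `u ∈ S` and `1` elsewhere. [folklore] -/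
noncomputable def localTwistChar (m : ZMod L) (x₀ : Site 2 L) (S : Finset (FermionTorus 2 L))
    (u : FermionTorus 2 L) : Circle :=
  if u ∈ S then twistChar m u.toTorusSite * (twistChar m x₀)⁻¹ else 1

/-- The complementary phases: `1` on `S`, the relative twist phases off `S`. [folklore] -/
noncomputable def outerTwistChar (m : ZMod L) (x₀ : Site 2 L) (S : Finset (FermionTorus 2 L))
    (u : FermionTorus 2 L) : Circle :=
  if u ∈ S then 1 else twistChar m u.toTorusSite * (twistChar m x₀)⁻¹

/-- Factorisation of the twist character: (local part) · (outer part) · (constant phase at `x₀`).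
[folklore] -/
theorem twistChar_eq_local_mul_outer_mul_const (m : ZMod L) (x₀ : Site 2 L)
    (S : Finset (FermionTorus 2 L)) :
    (fun u : FermionTorus 2 L => twistChar m u.toTorusSite) =
      localTwistChar m x₀ S * outerTwistChar m x₀ S * fun _ => twistChar m x₀ := by
  funext u
  simp only [Pi.mul_apply, localTwistChar, outerTwistChar]
  split_ifs <;> simp

/-- **The twist acts on `𝔄(S)` as the local relative twist**: for `A ∈ 𝔄(S)` and `ψ` in a joint
sector, `⟨W_mᴴψ, A W_mᴴψ⟩ = ⟨ψ, W^S A (W^S)ᴴ ψ⟩` with `W^S = phaseGauge (localTwistChar m x₀ S)`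
(the outer part commutes with `A`, the constant part is the scalar `χ_m(x₀)^{-N}` on the sector).
[folklore] -/
theorem twist_expect_eq_localTwist_expect (m : ZMod L) (x₀ : Site 2 L)
    (S : Finset (FermionTorus 2 L)) {A : Matrix (Finset (Orb (FermionTorus 2 L))) _ ℂ}
    (hA : A ∈ carSubalgebra (orbSet S)) {N : ℕ} {Mz : ℝ} {ψ : Fock (Orb (FermionTorus 2 L))}
    (hψ : ψ ∈ szSector N Mz) :
    star ((twistOp m)ᴴ *ᵥ ψ) ⬝ᵥ (A *ᵥ ((twistOp m)ᴴ *ᵥ ψ)) =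
      star ψ ⬝ᵥ ((phaseGauge (localTwistChar m x₀ S) * A *
        (phaseGauge (localTwistChar m x₀ S))ᴴ) *ᵥ ψ) := by
  set ρ := localTwistChar m x₀ S * outerTwistChar m x₀ S with hρ
  set c : Circle := twistChar m x₀ with hc
  -- split off the constant phase: `W_mᴴ ψ = c^{-N} · W_ρᴴ ψ`
  have hW : twistOp m = phaseGauge (fun _ : FermionTorus 2 L => c) * phaseGauge ρ := by
    rw [twistOp, twistChar_eq_local_mul_outer_mul_const m x₀ S, ← hρ, ← hc, phaseGauge_mul,
      mul_comm]
  have htw : (twistOp m)ᴴ *ᵥ ψ = ((c⁻¹ ^ N : Circle) : ℂ) • ((phaseGauge ρ)ᴴ *ᵥ ψ) := by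
    rw [hW, conjTranspose_mul, ← mulVec_mulVec]
    have h1 : (phaseGauge fun _ : FermionTorus 2 L => c)ᴴ *ᵥ ψ = ((c⁻¹ ^ N : Circle) : ℂ) • ψ := by
      rw [phaseGauge_conjTranspose]
      exact phaseGauge_const_mulVec_of_mem_szSector c⁻¹ hψ
    rw [h1, mulVec_smul]
  have hunit : star (((c⁻¹ ^ N : Circle) : ℂ)) * ((c⁻¹ ^ N : Circle) : ℂ) = 1 := by
    rw [Complex.star_def, mul_comm, Complex.mul_conj, Circle.normSq_coe, Complex.ofReal_one]
  rw [htw, star_smul, mulVec_smul, smul_dotProduct, dotProduct_smul, smul_eq_mul, smul_eq_mul,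
    ← mul_assoc, hunit, one_mul, star_conjTranspose_mulVec_dotProduct]
  -- the outer part commutes with `A`
  have hcomm : Commute (phaseGauge (outerTwistChar m x₀ S)) A :=
    commute_phaseGauge_of_mem_carSubalgebra (fun x hx => by simp [outerTwistChar, hx]) hA
  have hconj : phaseGauge ρ * A * (phaseGauge ρ)ᴴ =
      phaseGauge (localTwistChar m x₀ S) * A * (phaseGauge (localTwistChar m x₀ S))ᴴ := by
    rw [hρ, ← phaseGauge_mul, conjTranspose_mul]
    calc phaseGauge (localTwistChar m x₀ S) * phaseGauge (outerTwistChar m x₀ S) * A *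
          ((phaseGauge (outerTwistChar m x₀ S))ᴴ * (phaseGauge (localTwistChar m x₀ S))ᴴ)
        = phaseGauge (localTwistChar m x₀ S) * (phaseGauge (outerTwistChar m x₀ S) * A) *
            (phaseGauge (outerTwistChar m x₀ S))ᴴ * (phaseGauge (localTwistChar m x₀ S))ᴴ := by
          noncomm_ring
      _ = phaseGauge (localTwistChar m x₀ S) * A *
            (phaseGauge (outerTwistChar m x₀ S) * (phaseGauge (outerTwistChar m x₀ S))ᴴ) *
            (phaseGauge (localTwistChar m x₀ S))ᴴ := by rw [hcomm.eq]; noncomm_ring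
      _ = _ := by rw [phaseGauge_mul_conjTranspose_self, mul_one]
  rw [hconj]

/-- **The local relative twist is close to the identity**: if `S` lies in the `e₁`-columns
`x₀,₁, x₀,₁ + 1, …, x₀,₁ + D`, then `‖W^S - 1‖ ≤ 4 |S| · 2π j D / L` for the winding `j ∈ ℕ`.
[folklore] -/
theorem norm_phaseGauge_localTwistChar_sub_one_le (j : ℕ) (x₀ : Site 2 L)
    (S : Finset (FermionTorus 2 L)) (D : ℕ)
    (hS : ∀ u ∈ S, ∃ k : ℕ, k ≤ D ∧ u.toTorusSite 0 = x₀ 0 + k) :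
    ‖phaseGauge (localTwistChar (j : ZMod L) x₀ S) - 1‖ ≤
      4 * S.card * (2 * Real.pi * j * D / L) := by
  have hL : (0 : ℝ) < L := by exact_mod_cast Nat.pos_of_ne_zero (NeZero.ne L)
  have hterm : ∀ u : FermionTorus 2 L,
      ‖(localTwistChar (j : ZMod L) x₀ S u : ℂ) - 1‖ ≤
        if u ∈ S then 2 * Real.pi * j * D / L else 0 := by
    intro u
    by_cases hu : u ∈ S
    · obtain ⟨k, hkD, hk⟩ := hS u hu
      rw [if_pos hu, localTwistChar, if_pos hu]
      have hchar : twistChar (j : ZMod L) u.toTorusSite * (twistChar (j : ZMod L) x₀)⁻¹ =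
          ZMod.toCircle (1 : ZMod L) ^ (j * k) := by
        rw [twistChar, twistChar, hk, mul_add, AddChar.map_add_eq_mul, mul_inv_cancel_comm,
          ← AddChar.map_nsmul_eq_pow, nsmul_one, Nat.cast_mul]
      rw [hchar, ← Circle.coeHom_apply, map_pow, Circle.coeHom_apply]
      calc ‖(ZMod.toCircle (1 : ZMod L) : ℂ) ^ (j * k) - 1‖
          ≤ (j * k : ℕ) * ‖(ZMod.toCircle (1 : ZMod L) : ℂ) - 1‖ :=
            norm_pow_sub_one_le_of_norm_eq_one (Circle.norm_coe _) _
        _ ≤ (j * k : ℕ) * (2 * Real.pi / L) := by gcongr; exact norm_toCircle_one_sub_one_le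
        _ ≤ (j * D : ℕ) * (2 * Real.pi / L) := by
            gcongr
        _ = 2 * Real.pi * j * D / L := by push_cast; ring
    · rw [if_neg hu, localTwistChar, if_neg hu, Circle.coe_one, sub_self, norm_zero]
  calc ‖phaseGauge (localTwistChar (j : ZMod L) x₀ S) - 1‖
      ≤ 2 * ∑ u : FermionTorus 2 L, ‖(localTwistChar (j : ZMod L) x₀ S u : ℂ) - 1‖ :=
        norm_phaseGauge_sub_one_le _
    _ ≤ 2 * ∑ u : FermionTorus 2 L, (if u ∈ S then 2 * Real.pi * j * D / L else 0) := by
        gcongr with u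
        exact hterm u
    _ = 2 * (S.card * (2 * Real.pi * j * D / L)) := by
        rw [Finset.sum_ite_mem, Finset.univ_inter, Finset.sum_const, nsmul_eq_mul]
    _ ≤ 4 * S.card * (2 * Real.pi * j * D / L) := by
        have : (0 : ℝ) ≤ S.card * (2 * Real.pi * j * D / L) := by positivity
        linarith

/-- **Local observables see the twist only at order `j · D · |S| / L`**: for `A ∈ 𝔄(S)` with `S`
inside `D + 1` consecutive `e₁`-columns, `ψ` normalised in a joint sector and `j ∈ ℕ`,
`‖⟨W_jᴴψ, A W_jᴴψ⟩ - ⟨ψ, A ψ⟩‖ ≤ 16π j D |S| ‖A‖ / L`. H. Tasaki, arXiv:2202.06243 §3 (the twist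
as an almost-local `*`-automorphism). [folklore] -/
theorem norm_twist_expect_sub_expect_le (j : ℕ) (x₀ : Site 2 L)
    (S : Finset (FermionTorus 2 L)) (D : ℕ)
    (hS : ∀ u ∈ S, ∃ k : ℕ, k ≤ D ∧ u.toTorusSite 0 = x₀ 0 + k)
    {A : Matrix (Finset (Orb (FermionTorus 2 L))) _ ℂ} (hA : A ∈ carSubalgebra (orbSet S))
    {N : ℕ} {Mz : ℝ} {ψ : Fock (Orb (FermionTorus 2 L))} (hψ : ψ ∈ szSector N Mz)
    (h1 : star ψ ⬝ᵥ ψ = 1) :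
    ‖star ((twistOp (j : ZMod L))ᴴ *ᵥ ψ) ⬝ᵥ (A *ᵥ ((twistOp (j : ZMod L))ᴴ *ᵥ ψ)) -
        star ψ ⬝ᵥ (A *ᵥ ψ)‖ ≤ 16 * Real.pi * j * D * S.card * ‖A‖ / L := by
  set P := phaseGauge (localTwistChar (j : ZMod L) x₀ S) with hP
  rw [twist_expect_eq_localTwist_expect (j : ZMod L) x₀ S hA hψ, ← hP, ← dotProduct_sub,
    ← sub_mulVec]
  have hnormψ : ‖(WithLp.toLp 2 ψ : EuclideanSpace ℂ _)‖ = 1 := by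
    have h := norm_toLp_sq_eq_re ψ
    rw [h1, Complex.one_re] at h
    have h0 : (0 : ℝ) ≤ ‖(WithLp.toLp 2 ψ : EuclideanSpace ℂ _)‖ := norm_nonneg _
    nlinarith
  have hPH : ‖Pᴴ‖ ≤ 1 := by
    rw [hP, phaseGauge_conjTranspose]
    exact norm_phaseGauge_le_one _
  have hP1 := norm_phaseGauge_localTwistChar_sub_one_le j x₀ S D hS
  rw [← hP] at hP1
  calc ‖star ψ ⬝ᵥ ((P * A * Pᴴ - A) *ᵥ ψ)‖
      ≤ ‖(WithLp.toLp 2 ψ : EuclideanSpace ℂ _)‖ *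
          (‖P * A * Pᴴ - A‖ * ‖(WithLp.toLp 2 ψ : EuclideanSpace ℂ _)‖) :=
        ThermodynamicLimit.norm_star_dotProduct_mulVec_le _ ψ ψ
    _ = ‖P * A * Pᴴ - A‖ := by rw [hnormψ, one_mul, mul_one]
    _ ≤ 2 * ‖P - 1‖ * ‖A‖ := norm_conj_sub_le P A hPH
    _ ≤ 2 * (4 * S.card * (2 * Real.pi * j * D / L)) * ‖A‖ := by gcongr
    _ = 16 * Real.pi * j * D * S.card * ‖A‖ / L := by ring

/-- **Theorem 12: the d-wave order criterion is not robust under "energy + all local observables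
(+ all diagonal correlations)".** For all `t, U` and `c > 0` there are `ε` (`= 8π²|t|(M²+M)`),
`C` (`= 16π M`, `M = ⌊400/c⌋ + 1`) and `L₀` such that on every torus of side `L = n+1 ≥ L₀`, for
every normalised ground state `ψ` of every joint sector there is a normalised `φ` in the same
sector with energy `≤ E₀ + ε`, d-wave order `< c L⁴`, the same expectation as `ψ` for every
diagonal observable, and `‖⟨φ, A φ⟩ - ⟨ψ, A ψ⟩‖ ≤ C · D · |S| · ‖A‖ / L` for every set `S` of sites
inside `D + 1` consecutive `e₁`-columns and every `A` in the CAR algebra `𝔄(S)`. [this work] -/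
theorem dWave_order_not_locally_robust (t U c : ℝ) (hc : 0 < c) :
    ∃ ε : ℝ, ∃ C : ℝ, ∃ L₀ : ℕ, ∀ n : ℕ, L₀ ≤ n + 1 →
      ∀ {N : ℕ} {Mz : ℝ} {ψ : Fock (Orb (FermionTorus 2 (n + 1)))},
        IsGroundStateInSector (hubbardTorus 2 (n + 1) t U) N Mz ψ → star ψ ⬝ᵥ ψ = 1 →
        ∃ φ ∈ szSector N Mz, star φ ⬝ᵥ φ = 1 ∧
          (star φ ⬝ᵥ (hubbardTorus 2 (n + 1) t U *ᵥ φ)).re ≤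
              (hubbardTorus 2 (n + 1) t U).minEnergyOn (szSector N Mz) + ε ∧
          (star (pairField dWaveFormFactor (n + 1) *ᵥ φ) ⬝ᵥ
              (pairField dWaveFormFactor (n + 1) *ᵥ φ)).re < c * ((n : ℝ) + 1) ^ 4 ∧
          (∀ d : Finset (Orb (FermionTorus 2 (n + 1))) → ℂ,
            star φ ⬝ᵥ (diagonal d *ᵥ φ) = star ψ ⬝ᵥ (diagonal d *ᵥ ψ)) ∧
          ∀ (S : Finset (FermionTorus 2 (n + 1))) (x₀ : Site 2 (n + 1)) (D : ℕ),
            (∀ u ∈ S, ∃ k : ℕ, k ≤ D ∧ u.toTorusSite 0 = x₀ 0 + k) →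
            ∀ A ∈ carSubalgebra (orbSet S),
              ‖star φ ⬝ᵥ (A *ᵥ φ) - star ψ ⬝ᵥ (A *ᵥ ψ)‖ ≤ C * D * S.card * ‖A‖ / (n + 1) := by
  set M : ℕ := ⌊400 / c⌋₊ + 1 with hM
  refine ⟨8 * Real.pi ^ 2 * |t| * ((M : ℝ) ^ 2 + M), 16 * Real.pi * M, M + 3,
    fun n hn N Mz ψ hψ h1 => ?_⟩
  have hM1 : 1 ≤ M := by omega
  have hML : M < n + 1 := by omega
  obtain ⟨j, -, hjM, hE, hO⟩ := exists_twistIndex_low_energy_small_order (L := n + 1) (by omega)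
    t U hψ h1 dWaveFormFactor abs_dWaveFormFactor_le_one hM1 hML
  push_cast at hO
  refine ⟨(twistOp (j : ZMod (n + 1)))ᴴ *ᵥ ψ, twist_mem_szSector _ hψ.1,
    by rw [star_twist_dotProduct_twist, h1], hE, hO.trans_lt ?_,
    fun d => twist_expect_diagonal _ d ψ, fun S x₀ D hS A hA => ?_⟩
  · have hcM : 400 / c < M := by rw [hM]; push_cast; exact Nat.lt_floor_add_one _
    have hn4 : (0 : ℝ) < ((n : ℝ) + 1) ^ 4 := by positivity
    have hM0 : (0 : ℝ) < M := by exact_mod_cast hM1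
    rw [div_lt_iff₀ hM0]
    calc 400 * ((n : ℝ) + 1) ^ 4 = 400 / c * (c * ((n : ℝ) + 1) ^ 4) := by field_simp
      _ < M * (c * ((n : ℝ) + 1) ^ 4) := by gcongr
      _ = c * ((n : ℝ) + 1) ^ 4 * M := by ring
  · have h := norm_twist_expect_sub_expect_le (L := n + 1) j x₀ S D hS hA hψ.1 h1
    push_cast at h
    refine h.trans ?_
    have hjM' : (j : ℝ) ≤ M := by exact_mod_cast hjM
    have hn0 : (0 : ℝ) < (n : ℝ) + 1 := by positivity
    rw [div_le_div_iff_of_pos_right hn0]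
    have : (0 : ℝ) ≤ 16 * Real.pi * D * S.card * ‖A‖ := by positivity
    nlinarith

end Summit.HubbardSuperconductivity.HubbardSuperconductivity.Theorems.GaugeTwist
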